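import Literature.AnabelianGeometry.EtaleTheta.ConstantMultipleIndeterminacy
import Mathlib.CategoryTheory.SingleObj
import Mathlib.Topology.Instances.ZMod
import Mathlib.Algebra.Field.ZMod

/-!
# [EtTh] Corollary 5.12 (i)(ii)(iii): the universal closures over the abstract §5 interface are FALSE
# (kernel countermodel; FACT-LIST rows F-0505, F-0503, F-0501, F-0502 — R5 «named instances only»)

Mochizuki, *The étale theta function and its Frobenioid-theoretic manifestations*, Publ. RIMS **45**
(2009), Corollary 5.12 (pp.339–340 (PDF pp.113–114)) [cite: MochizukiEtTh2009, Cor 5.12 p.339 (PDF p.113)].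
Cell abc-iut, block F (fact-proving wave), seat abc-iut-f-112; PROOF-ONLY companion of abc-iut-L2-t4's
`ConstantMultipleIndeterminacy.lean` (statements `ConstantMultiple.IsoClassesDistinct` (i),
`ExistsLinearIota` (ii), `ConstantMultipleIndeterminacy` (iii), `ConstantMultipleIndeterminacyOfSystems`).
No new `Prop` fact, no edit of the statement file; the only definitions are the toy datum below.

WHAT IS PROVED.  The four statements are PREDICATES on the §5 data `𝔉 : ThetaFrobenioid C D` (the tree's
`PreFrobenioidData` + §5 extras — DATA ONLY: objects of `C` carry no line-bundle class, nothing says `C` is a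
Frobenioid) and on `R : ConstantMultiple.RootMorphismData 𝔉 V`.  Their universal closures («for EVERY such
datum») are refuted in the kernel by ONE toy datum `toyRoot` (all universes `0`):
* `C := Fin 2 × SingleObj (Multiplicative (ZMod 2))` — the walking arrow `0 ⟶ 1` times the one-object
  category on `ℤ/2`; base functor CONSTANT to `D := Discrete PUnit`; divisor monoids trivial; Frobenius
  degree `deg_Fr(φ) := 1` if `φ` preserves the `Fin 2`-coordinate and `2` otherwise (multiplicative, since at
  most one arrow of a composable pair in `Fin 2` moves);
* `A_N = B_N := Q = (1, ⋆)`, `s^⊓_N = s^⊔_N := 𝟙 Q`, `N := 2`; `A_{N'} = B_{N'} := P = (0, ⋆)`, `N' := 4`,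
  `α_{N,N'} = β_{N,N'} := (0 ⟶ 1, 1)` of Frobenius degree `M = 2`; `O^×(Q^birat) := ℤ/2`, `K := 𝔽₂`.
Then: (i) fails (`A_N = B_N`); (ii) fails (EVERY arrow `B_{N'} → B_N` has Frobenius degree `2`); (iii) at
`ζ = β` fails (the clauses "`A_N ↦ κ_A⁻¹`", "`B_N ↦ κ_B⁻¹`" with `κ_A = 1`, `κ_B =` the unit of order `2` of
`Q`, which lies in `(O_K^×)^{1/N}` because its square is `1`); the conjunction fails with (i).

WHAT THIS MEANS FOR THE ROWS (R5).  `IsoClassesDistinct` / `ExistsLinearIota` are NOT consequences of the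
abstract interface: print's proof (p.340 l.−8 – p.341 l.17) uses "all positive tensor powers of these line
bundles are nontrivial" and "the isomorphism classes of these line bundles are preserved by arbitrary
automorphisms of `B^bs`" ([EtTh] §1, discussion preceding Prop. 1.1) — statements about line bundles of
positive degree on the tempered covering, i.e. about the tempered-Frobenioid MODEL of `Ÿ`, which the
interface cannot express (sub-DAG plan/L2/SUBDAG-EtTh-Cor512.md rows L02/L03, abc-iut-w5-d238).  So the rows
are admissible AT NAMED INSTANCES ONLY; (iii) and the conjunction remain exactly L2-t4's PROVED reductions
`constantMultipleIndeterminacy_of` (⇐ (i)) and `constantMultipleIndeterminacyOfSystems_of` (⇐ (i), (ii)).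
HONEST FRAMING: a toy datum says nothing about the tempered Frobenioid of [EtTh] §5, nothing about the truth
of Cor. 5.12 for it, and nothing about [IUTchIII] Cor. 3.12; no side is taken; typed ≠ proved.
-/

namespace Literature.AnabelianGeometry.EtaleTheta

namespace ConstantMultiple

namespace Cor512Toy

open CategoryTheory
open Literature.AlgebraicGeometry.Frobenioids

/-- The coefficient group `ℤ/2`, written multiplicatively (plays `O^×(−^birat)` and the units of `Q`).
[cite: MochizukiEtTh2009, Cor 5.12 p.339 (PDF p.113)] -/
abbrev Mm : Type := Multiplicative (ZMod 2)

/-- The generator `m₀` of `ℤ/2`. [cite: MochizukiEtTh2009, Cor 5.12 p.339 (PDF p.113)] -/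
abbrev m0 : Mm := Multiplicative.ofAdd 1

/-- The toy category `C`: the walking arrow `Fin 2` times the one-object category on `ℤ/2`.
[cite: MochizukiEtTh2009, Cor 5.12 p.339 (PDF p.113)] -/
abbrev TC : Type := Fin 2 × SingleObj Mm

/-- The toy base category `D`: one object, one arrow. [cite: MochizukiEtTh2009, Cor 5.12 p.339 (PDF p.113)] -/
abbrev TD : Type := Discrete PUnit.{1}

/-- The object `P = (0, ⋆)` (plays `A_{N'} = B_{N'}`). [cite: MochizukiEtTh2009, Cor 5.12 p.339 (PDF p.113)] -/
abbrev P : TC := ((0 : Fin 2), SingleObj.star Mm)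

/-- The object `Q = (1, ⋆)` (plays `A_⊚ = A_N = B_N`). [cite: MochizukiEtTh2009, Cor 5.12 p.339 (PDF p.113)] -/
abbrev Q : TC := ((1 : Fin 2), SingleObj.star Mm)

/-- The toy Frobenius degree: `1` on arrows preserving the `Fin 2`-coordinate, `2` on the others.
[cite: MochizukiEtTh2009, Cor 5.12 p.339 (PDF p.113)] -/
def degFrToy {A B : TC} (_ : A ⟶ B) : ℕ+ := if A.1 = B.1 then 1 else 2

/-- Multiplicativity of the toy Frobenius degree along a composable pair.
[cite: MochizukiEtTh2009, Cor 5.12 p.339 (PDF p.113)] -/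
theorem degFrToy_comp {A B B' : TC} (ψ : A ⟶ B) (φ : B ⟶ B') :
    degFrToy (ψ ≫ φ) = degFrToy ψ * degFrToy φ := by
  obtain ⟨i, X⟩ := A
  obtain ⟨j, Y⟩ := B
  obtain ⟨k, Z⟩ := B'
  have h1 : i ≤ j := ψ.1.le
  have h2 : j ≤ k := φ.1.le
  simp only [degFrToy]
  fin_cases i <;> fin_cases j <;> fin_cases k <;> simp_all

/-- The toy pre-Frobenioid data: constant base, trivial divisors, the toy Frobenius degree.
[cite: MochizukiEtTh2009, Cor 5.12 p.339 (PDF p.113)] -/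
def toyPre : PreFrobenioidData.{0} TC TD where
  base := (Functor.const TC).obj ⟨PUnit.unit⟩
  Mon := fun _ => Unit
  pull := fun _ => MonoidHom.id Unit
  pull_id := fun _ _ => rfl
  pull_comp := fun _ _ _ => rfl
  div := fun _ => ()
  degFr := fun φ => degFrToy φ
  div_id := fun _ => rfl
  div_comp := fun _ _ => rfl
  degFr_id := fun A => by simp [degFrToy]
  degFr_comp := fun ψ φ => degFrToy_comp ψ φ

/-- Automorphism groups of the toy category are commutative (first coordinate: at most one arrow;
second: `ℤ/2`). [cite: MochizukiEtTh2009, Cor 5.12 p.339 (PDF p.113)] -/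
theorem aut_mul_comm (S : TC) (a b : Aut S) : a * b = b * a := by
  apply Aut.ext
  change (b.hom ≫ a.hom) = (a.hom ≫ b.hom)
  refine Prod.ext (Subsingleton.elim _ _) ?_
  exact @mul_comm Mm _ a.hom.2 b.hom.2

/-- `Aut_C(S) → ℤ/2`, the second coordinate of an automorphism (plays `O^×(S) ↪ O^×(S^birat)`).
[cite: MochizukiEtTh2009, Cor 5.12 p.339 (PDF p.113)] -/
def autToM (S : TC) : Aut S →* Mm where
  toFun a := a.hom.2
  map_one' := rfl
  map_mul' _ _ := rfl

/-- The toy `TemperedFrobenioidStub`: `O^×(S^birat) := ℤ/2`, units read through their second coordinate,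
trivial unit pull-backs, every arrow "of base-Frobenius type". [cite: MochizukiEtTh2009, Cor 5.12 p.339 (PDF p.113)] -/
def toyStub : FrobenioidTheta.TemperedFrobenioidStub.{0} TC TD where
  pre := toyPre
  units_comm S := ⟨⟨fun a b => Subtype.ext (aut_mul_comm S a.1 b.1)⟩⟩
  biratUnits := fun _ => Mm
  unitsToBirat S := (autToM S).comp (toyPre.unitsSubgroup S).subtype
  unitsToBirat_injective S := by
    intro a b h
    apply Subtype.ext
    apply Aut.ext
    exact Prod.ext (Subsingleton.elim _ _) h
  unitsPull := fun _ => 1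
  IsBaseFrobeniusType := ⊤

/-- `Ker(pr₁ : ℤ × ℤ/2 → ℤ) ≃ ℤ/2` (for the index-`2` clause of the §5 data).
[cite: MochizukiEtTh2009, Thm 5.10 (iii) proof p.335 (PDF p.109)] -/
def kerFstEquiv : (MonoidHom.fst (Multiplicative ℤ) Mm).ker ≃ ZMod 2 where
  toFun x := Multiplicative.toAdd x.1.2
  invFun g := ⟨(1, Multiplicative.ofAdd g), (MonoidHom.mem_ker).mpr rfl⟩
  left_inv x := by
    obtain ⟨⟨a, g⟩, h⟩ := x
    have h' : a = 1 := (MonoidHom.mem_ker).mp h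
    subst h'
    rfl
  right_inv _ := rfl

/-- The arrow `P ⟶ Q` (plays `α_{N,N'}` and `β_{N,N'}`), of toy Frobenius degree `2`.
[cite: MochizukiEtTh2009, Cor 5.12 p.339 (PDF p.113)] -/
def arrowPQ : P ⟶ Q := (homOfLE (by decide), 𝟙 (SingleObj.star Mm))

/-- **The toy §5 datum** `𝔉_toy : ThetaFrobenioid C D` (every field of the DATA-ONLY interface supplied;
`A_⊚ = A_N = B_N = Q`, `s^⊓_N = s^⊔_N = 𝟙`, `N = 2`, `l = 1`, `Π^tp_X = ℤ × ℤ/2` (discrete), `Π^tp_Ÿ = 1`,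
`K = 𝔽₂`, all sections trivial).  [cite: MochizukiEtTh2009, Cor 5.12 p.339 (PDF p.113)] -/
def toyTheta : ThetaFrobenioid.{0} TC TD where
  toTemperedFrobenioidStub := toyStub
  lDelta := fun _ => Unit
  lDeltaMap := fun _ => MonoidHom.id Unit
  l := 1
  odd_l := odd_one
  N := 2
  Acirc := Q
  AN := Q
  BN := Q
  sCap := 𝟙 Q
  sCup := 𝟙 Q
  base_map_sCap := rfl
  isPreStep_sCap := ⟨toyPre.degFr_id Q, by change IsIso (𝟙 _); infer_instance⟩
  isPreStep_sCup := ⟨toyPre.degFr_id Q, by change IsIso (𝟙 _); infer_instance⟩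
  PiX := Multiplicative ℤ × Mm
  zquot := MonoidHom.fst _ _
  zquot_surjective := fun z => ⟨(z, 1), rfl⟩
  PiYdd := ⊥
  PiYdd_le := bot_le
  relindex_PiYdd := by
    rw [Subgroup.relIndex_bot_left, Nat.card_congr kerFstEquiv, Nat.card_zmod]
  PiYdd_normal := inferInstance
  isOpen_PiYdd := isOpen_discrete _
  ρ := 1
  ρ_surjective := fun g => ⟨1, Aut.ext (Subsingleton.elim _ _)⟩
  isOpen_ker_ρ := isOpen_discrete _
  strv := 1
  sgpCap := 1
  sgpCup := 1
  K := ZMod 2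
  constEmb := 1
  constEmb_injective := by
    intro a b _
    have h : ∀ u : (ZMod 2)ˣ, u = 1 := by decide
    rw [h a, h b]
  thetaFn := (1 : Mm)

/-- The toy bi-Kummer vocabulary: both relations identically true (the stub constrains nothing).
[cite: MochizukiEtTh2009, Prop 5.2 p.324 (PDF p.98)] -/
def toyVocab : FrobenioidThetaBiKummer.BiKummerVocabStub toyTheta where
  IsRootOfRightFractionPair := fun _ _ _ _ _ _ _ => True
  IsRootOf := fun _ _ _ _ _ => True

/-- `A_N = Q` in the toy datum. [cite: MochizukiEtTh2009, Cor 5.12 p.339 (PDF p.113)] -/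
theorem toyTheta_AN : toyTheta.AN = Q := rfl

/-- `B_N = Q` in the toy datum. [cite: MochizukiEtTh2009, Cor 5.12 p.339 (PDF p.113)] -/
theorem toyTheta_BN : toyTheta.BN = Q := rfl

/-- `N = 2` in the toy datum. [cite: MochizukiEtTh2009, Cor 5.12 p.339 (PDF p.113)] -/
theorem toyTheta_N : toyTheta.N = 2 := rfl

/-- `s^⊓_N = 𝟙 Q` in the toy datum. [cite: MochizukiEtTh2009, Cor 5.12 p.339 (PDF p.113)] -/
theorem toyTheta_sCap : toyTheta.sCap = 𝟙 Q := rfl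

/-- `s^⊔_N = 𝟙 Q` in the toy datum. [cite: MochizukiEtTh2009, Cor 5.12 p.339 (PDF p.113)] -/
theorem toyTheta_sCup : toyTheta.sCup = 𝟙 Q := rfl

/-- In the toy datum, every arrow `P ⟶ Q` has Frobenius degree `2`.
[cite: MochizukiEtTh2009, Cor 5.12 p.339 (PDF p.113)] -/
theorem degFr_PQ (φ : P ⟶ Q) : toyTheta.degFr φ = 2 := by
  change degFrToy φ = 2
  simp [degFrToy]

/-- In the toy datum, every arrow `Q ⟶ Q` has Frobenius degree `1` (is linear).
[cite: MochizukiEtTh2009, Cor 5.12 p.339 (PDF p.113)] -/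
theorem degFr_QQ (φ : Q ⟶ Q) : toyTheta.degFr φ = 1 := by
  change degFrToy φ = 1
  simp [degFrToy]

/-- **The toy Corollary 5.12 data** `R_toy : RootMorphismData 𝔉_toy V_toy`: `N' = 4` (so `M = N'/N = 2 ≠ 1`),
`A_{N'} = B_{N'} = P`, `s^⊓_{N'} = s^⊔_{N'} = 𝟙 P`, `α = β = (P ⟶ Q)` isometries of Frobenius degree `2`.
[cite: MochizukiEtTh2009, Cor 5.12 p.339 (PDF p.113)] -/
def toyRoot : RootMorphismData toyTheta toyVocab where
  N' := 4
  dvd := ⟨2, rfl⟩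
  ne := show (2 : ℕ+) ≠ 4 from by decide
  AN' := P
  BN' := P
  sCap' := 𝟙 P
  sCup' := 𝟙 P
  isRoot := ⟨Q, 1, trivial, trivial⟩
  α := arrowPQ
  β := arrowPQ
  comm_sCap := by
    change 𝟙 P ≫ arrowPQ = arrowPQ ≫ 𝟙 Q
    simp only [Category.id_comp, Category.comp_id]
  comm_sCup := by
    change 𝟙 P ≫ arrowPQ = arrowPQ ≫ 𝟙 Q
    simp only [Category.id_comp, Category.comp_id]
  isIsometry_α := rfl
  degFr_α := show ((degFrToy arrowPQ : ℕ+) : ℕ) * 2 = 4 by simp [degFrToy]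
  isIsometry_β := rfl
  degFr_β := show ((degFrToy arrowPQ : ℕ+) : ℕ) * 2 = 4 by simp [degFrToy]
  baseFrob_α := trivial
  constEmb' := 1

/-! ### (i) `IsoClassesDistinct` -/

/-- Cor. 5.12 (i) FAILS at the toy datum: `A_N = B_N`.  [cite: MochizukiEtTh2009, Cor 5.12 (i) p.339 (PDF p.113)] -/
theorem not_isoClassesDistinct_toy : ¬ IsoClassesDistinct toyRoot :=
  fun h => h.1.false (Iso.refl Q)

/-- **F-0505: the universal closure of `ConstantMultiple.IsoClassesDistinct` is FALSE** (R5: the row is an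
assumption about NAMED §5 data, never a theorem of the interface).
[cite: MochizukiEtTh2009, Cor 5.12 (i) p.339 (PDF p.113)] -/
theorem not_forall_isoClassesDistinct :
    ¬ ∀ (C : Type) [Category.{0} C] (D : Type) [Category.{0} D] (𝔉 : ThetaFrobenioid.{0} C D)
        (V : FrobenioidThetaBiKummer.BiKummerVocabStub 𝔉) (R : RootMorphismData 𝔉 V),
        IsoClassesDistinct R :=
  fun h => not_isoClassesDistinct_toy (h TC TD toyTheta toyVocab toyRoot)

/-! ### (ii) `ExistsLinearIota` -/

/-- Cor. 5.12 (ii) FAILS at the toy datum: every `B_{N'} → B_N` has Frobenius degree `2`.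
[cite: MochizukiEtTh2009, Cor 5.12 (ii) p.340 (PDF p.114)] -/
theorem not_existsLinearIota_toy : ¬ ExistsLinearIota toyRoot := by
  rintro ⟨ι, hι⟩
  have h2 : toyTheta.degFr ι = 2 := degFr_PQ ι
  have h1 : toyTheta.degFr ι = 1 := hι
  rw [h1] at h2
  exact absurd h2 (by decide)

/-- **F-0503: the universal closure of `ConstantMultiple.ExistsLinearIota` is FALSE** (R5: named §5 data only).
[cite: MochizukiEtTh2009, Cor 5.12 (ii) p.340 (PDF p.114)] -/
theorem not_forall_existsLinearIota :
    ¬ ∀ (C : Type) [Category.{0} C] (D : Type) [Category.{0} D] (𝔉 : ThetaFrobenioid.{0} C D)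
        (V : FrobenioidThetaBiKummer.BiKummerVocabStub 𝔉) (R : RootMorphismData 𝔉 V),
        ExistsLinearIota R :=
  fun h => not_existsLinearIota_toy (h TC TD toyTheta toyVocab toyRoot)

/-! ### (iii) `ConstantMultipleIndeterminacy` and the conjunction -/

/-- The unit of order `2` of `Q`: the automorphism `(𝟙, m₀)` (base-identity and linear, so in `O^×(Q)`).
[cite: MochizukiEtTh2009, Cor 5.12 (iii) p.340 (PDF p.114)] -/
def unitQ : Aut Q where
  hom := (𝟙 (1 : Fin 2), m0)
  inv := (𝟙 (1 : Fin 2), m0)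
  hom_inv_id := Prod.ext (Subsingleton.elim _ _) (by decide : m0 * m0 = 1)
  inv_hom_id := Prod.ext (Subsingleton.elim _ _) (by decide : m0 * m0 = 1)

/-- `unitQ ∈ (O_K^×)^{1/N} ⊆ O^×(B_N)` in the toy datum (its square is `1`, which is a constant).
[cite: MochizukiEtTh2009, Lem 5.8 p.331 (PDF p.105)] -/
theorem unitQ_mem_OKxRootN : unitQ ∈ toyTheta.OKxRootN := by
  refine Subgroup.mem_map.mpr ⟨⟨unitQ, ⟨rfl, degFr_QQ unitQ.hom⟩⟩, ?_, rfl⟩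
  rw [Subgroup.mem_comap, ThetaFrobenioid.mem_KxRootN]
  exact ⟨1, (by decide : (1 : Mm) = m0 ^ 2)⟩

/-- Cor. 5.12 (iii) at `ζ = β_{N,N'}` FAILS at the toy datum: with `κ_A = 1`, `κ_B = unitQ` the clauses
"`A_N ↦ κ_A⁻¹`", "`B_N ↦ κ_B⁻¹`" are incompatible because `A_N = B_N`.
[cite: MochizukiEtTh2009, Cor 5.12 (iii) p.340 (PDF p.114)] -/
theorem not_constantMultipleIndeterminacy_toy : ¬ ConstantMultipleIndeterminacy toyRoot toyRoot.β := by
  intro h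
  have h1 := h 1 (one_mem _) unitQ unitQ_mem_OKxRootN 1 ⟨1, (OKxRootN' toyRoot).one_mem, one_pow _⟩
  obtain ⟨-, hA, hB, -⟩ := h1
  have h3 : (1 : Aut Q).inv = unitQ.inv := hA.symm.trans hB
  have h4 : (1 : Mm) = m0 := congrArg Prod.snd h3
  exact absurd (congrArg Multiplicative.toAdd h4) (by decide)

/-- **F-0501: the universal closure of `ConstantMultiple.ConstantMultipleIndeterminacy` is FALSE** — (iii) is
not a tautology of the interface; it holds ⇐ (i) (L2-t4's `constantMultipleIndeterminacy_of`), and (i) is a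
MODEL input.  [cite: MochizukiEtTh2009, Cor 5.12 (iii) p.340 (PDF p.114)] -/
theorem not_forall_constantMultipleIndeterminacy :
    ¬ ∀ (C : Type) [Category.{0} C] (D : Type) [Category.{0} D] (𝔉 : ThetaFrobenioid.{0} C D)
        (V : FrobenioidThetaBiKummer.BiKummerVocabStub 𝔉) (R : RootMorphismData 𝔉 V)
        (ζ : R.BN' ⟶ 𝔉.BN), ConstantMultipleIndeterminacy R ζ :=
  fun h => not_constantMultipleIndeterminacy_toy (h TC TD toyTheta toyVocab toyRoot toyRoot.β)

/-- The conjunction (i) ∧ (ii) ∧ (iii)@β ∧ (iii)@ι FAILS at the toy datum (already by (i)).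
[cite: MochizukiEtTh2009, Cor 5.12 p.339 (PDF p.113)] -/
theorem not_constantMultipleIndeterminacyOfSystems_toy : ¬ ConstantMultipleIndeterminacyOfSystems toyRoot :=
  fun h => not_isoClassesDistinct_toy h.1

/-- **F-0502: the universal closure of `ConstantMultiple.ConstantMultipleIndeterminacyOfSystems` is FALSE**
(R5: named §5 data only; it holds ⇐ (i) ∧ (ii) by L2-t4's `constantMultipleIndeterminacyOfSystems_of`).
[cite: MochizukiEtTh2009, Cor 5.12 p.339 (PDF p.113)] -/
theorem not_forall_constantMultipleIndeterminacyOfSystems :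
    ¬ ∀ (C : Type) [Category.{0} C] (D : Type) [Category.{0} D] (𝔉 : ThetaFrobenioid.{0} C D)
        (V : FrobenioidThetaBiKummer.BiKummerVocabStub 𝔉) (R : RootMorphismData 𝔉 V),
        ConstantMultipleIndeterminacyOfSystems R :=
  fun h => not_constantMultipleIndeterminacyOfSystems_toy (h TC TD toyTheta toyVocab toyRoot)

end Cor512Toy

end ConstantMultiple

end Literature.AnabelianGeometry.EtaleTheta
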